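import Literature.Computability.AlgebraicComplexity.BI17BinaryQuarticPolystableProofs
import Literature.Computability.AlgebraicComplexity.BI17GenericBinaryCubicPeriod
import Literature.Computability.AlgebraicComplexity.BI17NonNormalOrbitClosuresProofs
import HarnessLib

/-!
# The orbit closure of a generic binary quartic is not normal — BI 2017 Cor. 3.17 (2) at
# `(D, m) = (4, 2)`, unconditionally

Sibling proof file of `Literature/Computability/AlgebraicComplexity/BI17FundamentalInvariantForms.lean`
(cell `val-lit`, DAG row BI2017-A). P. Bürgisser, C. Ikenmeyer, *Fundamental invariants of orbit
closures*, J. Algebra 477 (2017) = arXiv:1511.02927, **Cor. 3.17 (2)** (TeX L1170–1178): "Suppose that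
`a'(D,m) = 1` and let `w ∈ Sym^D ℂ^m` be generic. Then `\overline{Gw}` is not normal if `D` is odd, or
if `D` is even and `gcd(D,m) > 1`." The named fact `BI2017_cor_3_17` is open in general (it rests on
Prop. 2.10, Luna 1973); here its instance `(D, m) = (4, 2)` — **the `GL₂`-orbit closure of almost
every binary quartic is NOT normal** — is PROVED, by composing three theorems of the tree:

* `BI2017_prop_A_4_holds` (App. Prop. 7.4 (2), file `BI17GenericBinaryCubicPeriod.lean`): almost all
  binary quartics have `a(w) = 2`, `a'(w) = 1`;
* `BI2017_prop_2_10_four_two` (`BI17BinaryQuarticPolystableProofs.lean`): almost all binary quartics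
  are polystable;
* `BI2017_cor_3_17_2_of_isZariskiGeneric_isPolystable` (`BI17NonNormalOrbitClosuresProofs.lean`): the
  per-degree form of the printed argument (`b(w) = m/gcd(D,m) = 1 < 2 = m ≤ e(w)`, Thm. 3.15, Thm. 3.10),
  with `gcd(4, 2) = 2 > 1`.

Honest framing: an explicit instance of a published corollary inside the BIP literature programme;
nothing here bears on lower bounds or on `VP` versus `VNP`.
-/

noncomputable section

open MvPolynomial

namespace Literature.Computability.AlgebraicComplexity

/-- **BI 2017, Cor. 3.17 (2) at `(D, m) = (4, 2)` (unconditional): the orbit closure of almost every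
binary quartic is not normal** — `IsZariskiGeneric 4 (¬ IsIntegrallyClosed (OrbitCoordRing · 4))` on
`Sym⁴ ℂ²`: generically `a'(w) = 1` (App. Prop. 7.4 (2)), generically polystable (Prop. 2.10 at
`(4, 2)`), and `gcd(4, 2) = 2 > 1`. [cite: BurgisserIkenmeyer2017, Cor. 3.17 (2) (case (D, m) = (4, 2))] -/
theorem BI2017_cor_3_17_2_four_two :
    IsZariskiGeneric 4 fun f : MvPolynomial (Fin 2) ℂ => ¬ IsIntegrallyClosed (OrbitCoordRing f 4) :=
  BI2017_cor_3_17_2_of_isZariskiGeneric_isPolystable (by norm_num) le_rfl BI2017_prop_2_10_four_two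
    (BI2017_prop_A_4_holds.2.1.mono fun _ _ h => h.2)
    (Or.inr (by decide))

/-- **Why there is no `(3, 2)` companion**: the hypothesis of Cor. 3.17 (2) FAILS generically for
binary cubics — "almost all binary cubics have `a'(w) = 1`" is false, since almost all have `a'(w) = 2`
(App. Prop. 7.4 (1), `BI2017_prop_A_4_holds`) and two generic properties are jointly satisfiable
(`IsZariskiGeneric.and`, `IsZariskiGeneric.exists_form`). So `BI2017_cor_3_17` (2) at `(3, 2)` holds
only vacuously. [cite: BurgisserIkenmeyer2017, Cor. 3.17 (2) and App. Prop. 7.4 (1)] -/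
theorem not_isZariskiGeneric_reducedStabilizerPeriod_eq_one_three_two :
    ¬ IsZariskiGeneric 3 (fun f : MvPolynomial (Fin 2) ℂ => reducedStabilizerPeriod 3 f = 1) := by
  intro h
  obtain ⟨f, -, h1, -, h2⟩ := IsZariskiGeneric.exists_form (h.and BI2017_prop_A_4_holds.1)
  rw [h2] at h1
  exact absurd h1 (by norm_num)

end Literature.Computability.AlgebraicComplexity

end
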